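import Summits.BirchSwinnertonDyer.BirchSwinnertonDyer.Theorems.SemiOrdinaryEisensteinDescentEisensteinKernelAtThree
import HarnessLib

/-!
# Route `SemiOrdinaryEisensteinDescent` (SOED), crux #2′ `WildSplitEisensteinInclusionAtThreeRestricted`
# (stmt-BirchSwinnertonDyer-24155): THE INDIVISIBILITY ROAD to the leaf — the kernel re-run with the whole
# (Eisenstein `E′`, Waldspurger #4, control #5) block replaced by the Heegner-side STEP L input
# «structure theorem, lower form» + «Manin-robust indivisibility of the Kolyvagin system at 3»
# (cell `pub/bsd-wall`, width seat `bsd-wall-soed-p1-w3` g5, `--supports 24155`, helper; no definition,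
# no named fact, no `sorry`)

## Why this file

The route's kernel (`semiOrdinaryEisensteinDescent_eisensteinKernelAtThree_proof`, kernel′ p590767, the
re-runs of p588074) consumes the Eisenstein crux E / E′ ONLY through its `T = 0` shadow: at the
Friedberg–Hoffstein field `K`, the datum `(Dt, H, ι, P = y_K)` and one frame, `E′ ∧ #4 ∧ #5` are read as
STEP L at slack `v₃(c)`,

  `SchneiderFree.IndexLowerBoundLeAt W 3 K P (v₃ c)` :
  `2·ord₃[E(K):ℤP] ≤ ord₃ #Ш(E/K) + 2·ord₃ ∏_ℓ c_ℓ(E) + 2·v₃(c)`,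

and nothing Λ-adic survives into the terminal step p528981. This file records, kernel-certified, that the
SAME socket is filled by a purely Heegner-side pair of inputs that the O5/O6 cell typed in
`Rank1Residual/Additive/WildThreeRefinedKolyvagin.lean` and that no file in the tree consumes:

* `AdditiveThree.OneClassLowerBoundShape` — Kolyvagin's STRUCTURE THEOREM at `p = 3` in its one-sided
  LOWER form (McCallum 1991 Thm. 5.4/5.8 as actually proved: ONE Kolyvagin class `c_M(n)` that is not
  `3^{m+1}`-divisible produces `Ш`): `¬ MinftyGe … (m+1) ⟹ 2·ord₃[E(K):ℤP] ≤ ord₃ #Ш(E/K) + 2m`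
  (tower surjectivity, `d_K ≠ −3, −4`, `P = y_K` non-torsion);
* the MANIN-ROBUST INDIVISIBILITY of the Heegner-point Kolyvagin system at `3` on the cell's data:
  `¬ MinftyGe W K Dt H.β ι (ord₃ ∏_ℓ c_ℓ(E) + v₃(c(Dt)) + 1)` — «`M_∞ ≤ ord₃(c·∏c_ℓ)`», the Zhang / BCGS
  direction of the refined Kolyvagin conjecture (`AdditiveThree.RKC3Indivisibility` is the case `3 ∤ c`)
  with the Manin slack the kernel carries anyway; OPEN at an additive `3` (W. Zhang 2014 / BCGS need
  `p ≥ 5` good ordinary and BD-admissible primes, of which there are none at `p = 3`), but — unlike the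
  Λ-adic `E′` — CERTIFIABLE PAIR BY PAIR by exhibiting ONE derived class (Jetchev–Lauter–Stein 2009 §4).

## What is proved

* §1 `indexLowerBoundLeAt_of_oneClassLowerBound_of_not_minftyGe` — pointwise: structure (lower form) +
  indivisibility at budget `ord₃∏c_ℓ + s` ⟹ `IndexLowerBoundLeAt W 3 K P s` (one line of arithmetic).
* §2 `wAllExclAddWildRankOneSurj_of_indivisibility` — THE ROAD:
  `PublishedInputsWildThree → OneClassLowerBoundShape → [Manin-robust indivisibility on the cell] →
  WildKolyvaginUpperAtThree → WildRankZeroTwistAtThree → WildRankOneSurjNonTowerAtThree →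
  WAllExclAddWildRankOneSurj` (p588074's kernel verbatim up to step (a); step (b) — frame, Waldspurger value,
  control, Eisenstein inclusion, norm receptacle — is GONE; (c) = p528981 unchanged). No `p`-adic
  `L`-function, no main conjecture, no control theorem enters.
* §3 `indexLowerBoundLeAt_iff_le_of_structure_of_minftyEq` — under the two-sided structure SHAPE
  (`AdditiveThree.KolyvaginStructureThreeShape`, `M_∞ = m`): STEP L at slack `s` ⟺ `m ≤ ord₃∏c_ℓ + s`, i.e.
  the Eisenstein half in index currency IS the indivisibility statement, pair by pair (planning reading:
  crux #2′'s kernel content = «`M_∞ ≤ ord₃(c·∏c_ℓ)`»; its partner Ko = «`M_∞ ≥ ord₃(c·∏c_ℓ)`», crux J).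

HONEST STATUS: a ROAD, not an engine — both Heegner-side inputs are hypotheses (the structure theorem at
`p = 3` with `27 ∣ N` is McCallum's, flagged «p ∣ N reading to be confirmed» in the O5/O6 file; the
indivisibility is research-open class-wide); every crux is an antecedent; `E′` is NOT claimed false and is
not used; BSD is not proved for any curve. Supports, does not close, stmt-BirchSwinnertonDyer-24155.

References: [McCallumLMS1991] Thm. 5.4 (p. 288), Thm. 5.8 (p. 290); [KolyvaginEulerSystems1990] Thm. 1;
[WZhang2014] Thm. 1.1, §3.8, Thm. 10.2, Remark 18; [Jetchev2008] Conj. 1.3, Thm. 1.4;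
[BurungaleEtAl2026] Thm. 2 (arXiv:2312.09301); [JetchevLauterStein2009] Prop. 4.1–4.2 (arXiv:0707.0032);
[JetchevSkinnerWan2017] §7.4.1 (arXiv:1512.06894 p. 30); [GrossZagier1986] Thm. I.(6.3), V.§2;
[FriedbergHoffstein1995] Thm. B; [GrossLMS1991] Prop. 6.2.
-/

noncomputable section

open scoped Classical

set_option linter.dupNamespace false -- `Summit.BirchSwinnertonDyer.BirchSwinnertonDyer.Theorems.…` (summit = sub)
set_option autoImplicit false

namespace Summit.BirchSwinnertonDyer.BirchSwinnertonDyer.Theorems.WildSplitEisensteinInclusionAtThreeIndivisibilityRoad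

open WeierstrassCurve NumberField IsDedekindDomain Field
  Literature.NumberTheory.EllipticCurves
  Literature.NumberTheory.EllipticCurves.ModularForms
  Literature.NumberTheory.EllipticCurves.Rank1Residual
  Literature.NumberTheory.EllipticCurves.KrizLi2019
  Summit.BirchSwinnertonDyer.Rank1Residual
  Summit.BirchSwinnertonDyer.Rank1Residual.Additive
  Summit.BirchSwinnertonDyer.Rank1Residual.X11b
  Summit.BirchSwinnertonDyer.BirchSwinnertonDyer.Theses.SemiOrdinaryEisensteinDescent
  Summit.BirchSwinnertonDyer.BirchSwinnertonDyer.Theorems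

/-! ### §1 Pointwise: structure (lower form) + indivisibility at budget `ord₃∏c_ℓ + s` ⟹ STEP L at slack `s` -/

/-- **STEP L at slack `s` from ONE indivisible class.** At a datum `(W, K, Dt, H, ι, P)` of the structure
theorem's shape (tower surjectivity, `d_K ≠ −3, −4`, Heegner hypothesis for `N_E`, `P` the Heegner point, of
infinite order): if some genuine Kolyvagin class is NOT `3^{ord₃∏c_ℓ + s + 1}`-divisible, then
`2·ord₃[E(K):ℤP] ≤ ord₃ #Ш(E/K) + 2·ord₃∏_ℓ c_ℓ(E) + 2s` — the kernel's LOWER socket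
`SchneiderFree.IndexLowerBoundLeAt W 3 K P s`. One line of arithmetic from `OneClassLowerBoundShape` at
`m = ord₃∏c_ℓ + s`; the structure theorem is a HYPOTHESIS. [cite: McCallumLMS1991, Thm. 5.4 (p. 288)]
[cite: JetchevSkinnerWan2017, §7.4.1 (eq:shalowerK-1)] -/
theorem indexLowerBoundLeAt_of_oneClassLowerBound_of_not_minftyGe
    (hSL : AdditiveThree.OneClassLowerBoundShape)
    (W : WeierstrassCurve ℚ) [W.IsElliptic] [W.IsGloballyMinimal] (hρ : AdditiveThree.TowerSurjThree W)
    (K : Type) [Field K] [NumberField K] (hK : IsImaginaryQuadratic K)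
    (h3 : NumberField.discr K ≠ -3) (h4 : NumberField.discr K ≠ -4)
    [NeZero (W.conductorNorm ℤ)] (hHN : SatisfiesHeegnerHypothesis (W.conductorNorm ℤ) K)
    (Dt : ModularParametrizationData W (W.conductorNorm ℤ))
    (H : HeegnerDatum (W.conductorNorm ℤ) (NumberField.discr K)) (ι : K →+* ℂ)
    (P : (W.baseChange K).toAffine.Point)
    (hP : WeierstrassCurve.Affine.Point.map ι.toRatAlgHom P = heegnerPointComplex Dt H)
    (hnt : ¬ IsOfFinAddOrder P) (s : ℕ)
    (hInd : ¬ AdditiveThree.MinftyGe W K Dt H.β ι (padicValNat 3 W.tamagawaProduct + s + 1)) :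
    SchneiderFree.IndexLowerBoundLeAt W 3 K P s := by
  have h := hSL W hρ K hK h3 h4 hHN Dt H ι P hP hnt (padicValNat 3 W.tamagawaProduct + s) hInd
  unfold SchneiderFree.IndexLowerBoundLeAt
  omega

/-! ### §2 THE INDIVISIBILITY ROAD: published inputs → structure (lower) → Manin-robust indivisibility →
Kolyvagin upper bound → rank-zero twist → non-tower residual ⟹ the leaf -/

/-- **The SOED leaf by the INDIVISIBILITY ROAD.** Hypotheses: the route's published inputs
`PublishedInputsWildThree`; Kolyvagin's structure theorem at `3`, lower form (`OneClassLowerBoundShape`);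
`hInd` = the MANIN-ROBUST INDIVISIBILITY of the Heegner-point Kolyvagin system at `3` on the cell's data
(displayed: for `W` on `ClassO6 W 3` with `ρ̄_{E,3}` onto and `r_an = 1`, every Heegner field `K` for `N_E`
with `L(E^{(d_K)},1) ≠ 0`, `d_K` odd, `d_K ≠ −3`, the datum `(Dt, H, ι)` at level `N_E` and its Heegner point
`P = y_K` of infinite order, under `3`-adic tower surjectivity: SOME genuine class `c_M(n)` is not
`3^{ord₃∏c_ℓ(E) + v₃(c(Dt)) + 1}`-divisible — «`M_∞ ≤ ord₃(c·∏c_ℓ)`», refined Kolyvagin conjecture,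
Zhang/BCGS direction with Manin slack); the route's cruxes #3 `WildKolyvaginUpperAtThree` (co-STEP L), #6
`WildRankZeroTwistAtThree`, #7 `WildRankOneSurjNonTowerAtThree`. Conclusion: the leaf
`WAllExclAddWildRankOneSurj`. Proof = p588074 `wAllExclAddWildRankOneSurj_of_valueAtOneRestricted` steps
(o), (a), (c) VERBATIM; step (b) (anticyclotomic frame, Waldspurger value, control count, Eisenstein
inclusion, norm receptacle) is replaced by §1. Every input is an antecedent; BSD is not proved by this.
[cite: McCallumLMS1991, Thm. 5.4 (p. 288), Thm. 5.8 (p. 290)] [cite: WZhang2014, Thm. 1.1 and Remark 18]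
[cite: JetchevSkinnerWan2017, §7.4.1 (arXiv:1512.06894 p. 30)] [cite: GrossZagier1986, Thm. I.(6.3) and V.§2]
[cite: FriedbergHoffstein1995, Thm. B] -/
theorem wAllExclAddWildRankOneSurj_of_indivisibility (hF : PublishedInputsWildThree)
    (hSL : AdditiveThree.OneClassLowerBoundShape)
    (hInd : ∀ (W : WeierstrassCurve ℚ) [W.IsElliptic] [W.IsGloballyMinimal] [NeZero (W.conductorNorm ℤ)]
      (K : Type) [Field K] [NumberField K]
      (Dt : Literature.NumberTheory.EllipticCurves.ModularForms.ModularParametrizationData W (W.conductorNorm ℤ))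
      (H : Literature.NumberTheory.EllipticCurves.HeegnerDatum (W.conductorNorm ℤ) (NumberField.discr K))
      (ι : K →+* ℂ) (P : (W.baseChange K).toAffine.Point),
      Summit.BirchSwinnertonDyer.Rank1Residual.Additive.ClassO6 W 3 → W.HasSurjectiveModNGaloisRep 3 →
      W.analyticRank = 1 → Literature.NumberTheory.EllipticCurves.IsImaginaryQuadratic K →
      Literature.NumberTheory.EllipticCurves.SatisfiesHeegnerHypothesis (W.conductorNorm ℤ) K →
      (W.quadraticTwist (NumberField.discr K : ℚ)).entireLFunction 1 ≠ 0 →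
      (WeierstrassCurve.Affine.Point.map ι.toRatAlgHom) P =
        Literature.NumberTheory.EllipticCurves.ModularForms.heegnerPointComplex Dt H →
      ¬ IsOfFinAddOrder P → Odd (NumberField.discr K) → NumberField.discr K ≠ -3 →
      Summit.BirchSwinnertonDyer.Rank1Residual.AdditiveThree.TowerSurjThree W →
      ¬ Summit.BirchSwinnertonDyer.Rank1Residual.AdditiveThree.MinftyGe W K Dt H.β ι
          (padicValNat 3 W.tamagawaProduct + padicValNat 3 Dt.c.natAbs + 1))
    (hKoly : WildKolyvaginUpperAtThree) (hZ : WildRankZeroTwistAtThree) (hNT : WildRankOneSurjNonTowerAtThree) :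
    Summit.BirchSwinnertonDyer.WAllExclAddWildRankOneSurj := by
  unfold Summit.BirchSwinnertonDyer.WAllExclAddWildRankOneSurj
  intro W _ _ hncm hO6 hsurj hr
  -- (o) TOWER SPLIT: off the tower-surjective rows the residual crux pays by name
  by_cases htower : AdditiveThree.TowerSurjThree W
  swap
  · exact hNT W hncm hO6 hsurj htower hr
  obtain ⟨hGZ, hKo, hGZK, hmod, hmodP, -, hGZ73, hFH, hpar, hHP⟩ := hF
  haveI hN0 : NeZero (W.conductorNorm ℤ) := ⟨W.conductorNorm_pos_holds.ne'⟩
  -- (a) DATA. parity: `r_an = 1` is odd, so `w(E) = -1`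
  have hw : W.rootNumber = -1 := by
    rcases W.rootNumber_eq_one_or with h | h
    · exfalso
      have heven : Even W.analyticRank := (hpar W).mpr h
      rw [hr] at heven
      exact Nat.not_even_one heven
    · exact h
  -- Friedberg–Hoffstein with auxiliary modulus `2`: Heegner for `N(E)`, `2` split, `L(E^{(d_K)},1) ≠ 0`
  obtain ⟨K, _, _, hK, -, hHN, hH2, hLt⟩ := hFH W hw 2 two_ne_zero 0
  have hodd : Odd (NumberField.discr K) := by
    have h8 := Literature.SatisfiesHeegnerHypothesis.discr_emod_eight hK.1 hH2 (dvd_refl 2)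
    rw [Int.odd_iff]; omega
  have hd4 : NumberField.discr K ≠ -4 := by
    intro h
    have h2 := Int.odd_iff.mp hodd
    omega
  -- `3 ∣ N(E)` (additive) splits in `K`; hence `d_K ≠ -3`
  have h3N : 3 ∣ W.conductorNorm ℤ :=
    (W.dvd_conductorNorm_iff_not_hasGoodReductionAtPrime 3).mpr (not_good_of_addv W 3 hO6.2.1)
  have hd3 : NumberField.discr K ≠ -3 := by
    intro h
    exact Literature.SatisfiesHeegnerHypothesis.not_dvd_discr hK.1 hHN Nat.prime_three h3N
      (by rw [h]; norm_num)
  -- the Heegner point over `K` and its datum; non-torsion by Gross–Zagier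
  obtain ⟨P, Dt, H, ι, hP⟩ := hHP W K hK hHN
  have hL0 : W.entireLFunction 1 = 0 := entireLFunction_one_eq_zero_of_analyticRank_eq_one hr
  obtain ⟨-, hderiv⟩ := leadingLCoeff_eq_deriv_of_analyticRank_eq_one hr
  have hLK : LDerivEK W K ≠ 0 := by
    rw [lDerivEK_eq_deriv_mul W K hmod hL0]; exact mul_ne_zero hderiv hLt
  have hnt : ¬ IsOfFinAddOrder P :=
    (lDerivEK_ne_zero_iff_not_isOfFinAddOrder W (W.conductorNorm ℤ) K (hGZ _ W K) hK hHN
      ⟨Dt, H, ι, hP⟩).mp hLK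
  -- (b′) THE LOWER socket at slack `v₃(c)` from the structure theorem (lower form) + ONE indivisible class
  have hlo : SchneiderFree.IndexLowerBoundLeAt W 3 K P (padicValNat 3 Dt.c.natAbs) :=
    indexLowerBoundLeAt_of_oneClassLowerBound_of_not_minftyGe hSL W htower K hK hd3 hd4 hHN Dt H ι P hP
      hnt (padicValNat 3 Dt.c.natAbs)
      (hInd W K Dt H ι P hO6 hsurj hr hK hHN hLt hP hnt hodd hd3 htower)
  -- the UPPER socket at slack `v₃(c)` IS the Kolyvagin crux (tower surjectivity, `d_K` odd, `≠ -3`)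
  have hupI : SchneiderFree.Upper.IndexUpperBoundLeAt W 3 K P (padicValNat 3 Dt.c.natAbs) :=
    hKoly W (W.conductorNorm ℤ) K Dt H ι P hO6 hsurj hr rfl hK hHN hLt hP hnt hodd hd3 htower
  -- (c) TERMINAL STEP: a globally minimal model of the twist, then p528981
  have hD0 : (NumberField.discr K : ℚ) ≠ 0 := by exact_mod_cast NumberField.discr_ne_zero K
  haveI : (W.quadraticTwist (NumberField.discr K : ℚ)).IsElliptic := W.isElliptic_quadraticTwist hD0
  obtain ⟨Cd, hCd⟩ := hasGlobalMinimalModel_rat_holds (W.quadraticTwist (NumberField.discr K : ℚ))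
  haveI : (Cd • W.quadraticTwist (NumberField.discr K : ℚ)).IsGloballyMinimal := hCd
  exact SchneiderFree.Exact.bsdp_three_of_exactIndexManin_of_wAllExclAddWildRankZero hGZ hKo hGZK hmod
    hGZ73 hZ W hO6 hsurj hr (W.conductorNorm ℤ) K Dt H ι P
    (Cd • W.quadraticTwist (NumberField.discr K : ℚ)) rfl hK hodd hHN hLt hP ⟨Cd, rfl⟩ hlo hupI

/-! ### §3 Under the two-sided structure shape: STEP L in index currency IS the indivisibility statement -/

/-- **STEP L ⟺ indivisibility, pair by pair, granted the structure theorem.** If Kolyvagin's structure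
theorem holds in the two-sided shape `AdditiveThree.KolyvaginStructureThreeShape`
(`ord₃ #Ш(E/K) + 2·M_∞ = 2·ord₃[E(K):ℤP]`) and `M_∞ = m` at the datum (`MinftyEq … m`), then the kernel's
LOWER socket at slack `s` holds iff `m ≤ ord₃∏_ℓ c_ℓ(E) + s`: the Eisenstein half of the route, read where
the kernel reads it, is EXACTLY «the Kolyvagin system is not more divisible than the Tamagawa–Manin
budget» — the refined Kolyvagin conjecture's indivisibility half (and its partner crux #3 is the
divisibility half `m ≥ …`). Planning reading only; both shapes are hypotheses. [cite: WZhang2014, §3.8 and Remark 18]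
[cite: Jetchev2008, Conj. 1.3] [cite: McCallumLMS1991, Thm. 5.8 (p. 290)] -/
theorem indexLowerBoundLeAt_iff_le_of_structure_of_minftyEq
    (hS : AdditiveThree.KolyvaginStructureThreeShape)
    (W : WeierstrassCurve ℚ) [W.IsElliptic] [W.IsGloballyMinimal] (hρ : AdditiveThree.TowerSurjThree W)
    (K : Type) [Field K] [NumberField K] (hK : IsImaginaryQuadratic K)
    (h3 : NumberField.discr K ≠ -3) (h4 : NumberField.discr K ≠ -4)
    [NeZero (W.conductorNorm ℤ)] (hHN : SatisfiesHeegnerHypothesis (W.conductorNorm ℤ) K)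
    (Dt : ModularParametrizationData W (W.conductorNorm ℤ))
    (H : HeegnerDatum (W.conductorNorm ℤ) (NumberField.discr K)) (ι : K →+* ℂ)
    (P : (W.baseChange K).toAffine.Point)
    (hP : WeierstrassCurve.Affine.Point.map ι.toRatAlgHom P = heegnerPointComplex Dt H)
    (hnt : ¬ IsOfFinAddOrder P) {m : ℕ} (hm : AdditiveThree.MinftyEq W K Dt H.β ι m) (s : ℕ) :
    SchneiderFree.IndexLowerBoundLeAt W 3 K P s ↔ m ≤ padicValNat 3 W.tamagawaProduct + s := by
  obtain ⟨-, h⟩ := hS W hρ K hK h3 h4 hHN Dt H ι P hP hnt m hm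
  unfold SchneiderFree.IndexLowerBoundLeAt
  omega

end Summit.BirchSwinnertonDyer.BirchSwinnertonDyer.Theorems.WildSplitEisensteinInclusionAtThreeIndivisibilityRoad

end
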